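import Mathlib
import Literature.Probability.LatticeModels.CriticalTwoPointLower

/-!
# Exchangeability is free for Gaussian scale mixtures representing the critical two-point function

Used by line `Sketch` of the crux `CriticalTwoPointGSM` (stmt-CriticalPhenomena-8365): if the
critical two-point function `G(x) = ⟨σ₀σ_x⟩⁺_{β_c}` of the nearest-neighbour Ising model on `ℤ³` is
represented as `G(x) = ∫ exp(-∑ᵢ sᵢ xᵢ²) dμ(s)` by a probability measure `μ` carried by the closed
octant `{s | ∀ i, 0 ≤ sᵢ}`, then it is represented in the same way by an EXCHANGEABLE such measure,
namely the `S₃`-average `ν = (1/6) ∑_σ (s ↦ s ∘ σ)_* μ` of the push-forwards of `μ` under the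
coordinate permutations.

Proof: each push-forward `(· ∘ σ)_* μ` is a probability measure carried by the closed octant (the
defect set `{s | ∃ i, sᵢ < 0}` is permutation invariant) and, by the change-of-variables formula, it
represents `x ↦ G(x ∘ σ⁻¹)`, which is `G` by the symmetry of `⟨σ₀σ_x⟩⁺_β` under coordinate
permutations (Friedli–Velenik 2017, Exercise 3.14; `twoPointPlus_perm_invariant_holds`). These three
properties pass to the average, and the average over the group `S₃` is invariant under every
`(· ∘ τ)_*` (re-index the sum by `σ ↦ σ τ`).
-/

namespace Summit.CriticalPhenomena.Ising3DConformalLimit.Theorems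

open MeasureTheory
open Literature.Probability.LatticeModels
open scoped BigOperators

namespace CriticalTwoPointGSMSymm

-- adapted from Cruxes/CriticalTwoPointGSM/Disproof.lean
-- (refuter-cdisprove-stmt-CriticalPhenomena-8365-0; its `permS`, `symmMeasure`, `gsm_of_rep`)

/-- The coordinate permutations `s ↦ s ∘ σ` of the parameter space `ℝ³` are measurable. -/
theorem measurable_compPerm (σ : Equiv.Perm (Fin 3)) : Measurable fun s : Fin 3 → ℝ => s ∘ σ :=
  measurable_pi_lambda _ fun i => measurable_pi_apply (σ i)

/-- Composition of coordinate permutations: `(· ∘ τ) ∘ (· ∘ σ) = (· ∘ σ τ)`. -/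
theorem compPerm_comp_compPerm (σ τ : Equiv.Perm (Fin 3)) :
    ((fun s : Fin 3 → ℝ => s ∘ τ) ∘ fun s : Fin 3 → ℝ => s ∘ σ) =
      fun s : Fin 3 → ℝ => s ∘ (σ * τ) :=
  rfl

/-- The octant-defect set `{s | ∃ i, sᵢ < 0}` is invariant under coordinate permutations. -/
theorem preimage_compPerm_exists_neg (σ : Equiv.Perm (Fin 3)) :
    (fun s : Fin 3 → ℝ => s ∘ σ) ⁻¹' {s : Fin 3 → ℝ | ∃ i, s i < 0} = {s | ∃ i, s i < 0} := by
  ext s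
  simp only [Set.mem_preimage, Set.mem_setOf_eq, Function.comp_apply]
  constructor
  · rintro ⟨i, hi⟩
    exact ⟨σ i, hi⟩
  · rintro ⟨i, hi⟩
    exact ⟨σ.symm i, by simpa using hi⟩

/-- The push-forward of a measure carried by the closed octant under a coordinate permutation is
carried by the closed octant. -/
theorem map_compPerm_exists_neg {μ : Measure (Fin 3 → ℝ)} (hoct : μ {s | ∃ i, s i < 0} = 0)
    (σ : Equiv.Perm (Fin 3)) :
    (μ.map fun s : Fin 3 → ℝ => s ∘ σ) {s | ∃ i, s i < 0} = 0 := by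
  rw [Measure.map_apply (measurable_compPerm σ) (by measurability), preimage_compPerm_exists_neg,
    hoct]

/-- The Gaussian kernel `s ↦ exp(-∑ᵢ sᵢ xᵢ²)` is continuous. -/
theorem continuous_kernel (x : Site 3) :
    Continuous fun s : Fin 3 → ℝ => Real.exp (-∑ i, s i * ((x i : ℝ)) ^ 2) := by
  fun_prop

/-- The Gaussian kernel `s ↦ exp(-∑ᵢ sᵢ xᵢ²)` is integrable against every finite measure carried by
the closed octant (it is continuous and bounded by `1` there). -/
theorem integrable_kernel {μ : Measure (Fin 3 → ℝ)} [IsFiniteMeasure μ]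
    (hoct : μ {s | ∃ i, s i < 0} = 0) (x : Site 3) :
    Integrable (fun s : Fin 3 → ℝ => Real.exp (-∑ i, s i * ((x i : ℝ)) ^ 2)) μ := by
  refine Integrable.mono' (integrable_const (1 : ℝ)) (continuous_kernel x).aestronglyMeasurable ?_
  have hae : ∀ᵐ s ∂μ, ∀ i, 0 ≤ s i := by
    rw [ae_iff]
    have h : {s : Fin 3 → ℝ | ¬∀ i, 0 ≤ s i} = {s | ∃ i, s i < 0} := by
      ext s
      simp [not_le]
    rw [h]
    exact hoct
  filter_upwards [hae] with s hs
  rw [Real.norm_eq_abs, abs_of_pos (Real.exp_pos _), Real.exp_le_one_iff]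
  have h : 0 ≤ ∑ i, s i * ((x i : ℝ)) ^ 2 :=
    Finset.sum_nonneg fun i _ => mul_nonneg (hs i) (sq_nonneg _)
  linarith

/-- The Gaussian kernel at a permuted parameter is the kernel at the inversely permuted site:
`exp(-∑ᵢ s_{σ i} xᵢ²) = exp(-∑ᵢ sᵢ x_{σ⁻¹ i}²)`. -/
theorem kernel_compPerm (x : Site 3) (σ : Equiv.Perm (Fin 3)) (s : Fin 3 → ℝ) :
    Real.exp (-∑ i, (s ∘ σ) i * ((x i : ℝ)) ^ 2) =
      Real.exp (-∑ i, s i * (((fun j => x (σ.symm j)) i : ℝ)) ^ 2) := by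
  congr 2
  refine Fintype.sum_equiv σ _ _ fun i => ?_
  simp

/-- Each push-forward of a representing measure under a coordinate permutation again represents the
critical two-point function (change of variables and the permutation symmetry of `⟨σ₀σ_x⟩⁺_{β_c}`,
Friedli–Velenik 2017, Exercise 3.14). -/
theorem rep_map_compPerm {μ : Measure (Fin 3 → ℝ)}
    (hrep : ∀ x : Site 3, criticalTwoPoint 3 x = ∫ s, Real.exp (-∑ i, s i * ((x i : ℝ)) ^ 2) ∂μ)
    (σ : Equiv.Perm (Fin 3)) (x : Site 3) :
    criticalTwoPoint 3 x =
      ∫ s, Real.exp (-∑ i, s i * ((x i : ℝ)) ^ 2) ∂(μ.map fun s : Fin 3 → ℝ => s ∘ σ) := by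
  rw [integral_map (measurable_compPerm σ).aemeasurable (continuous_kernel x).aestronglyMeasurable]
  have hx : criticalTwoPoint 3 x = criticalTwoPoint 3 fun j => x (σ.symm j) :=
    (twoPointPlus_perm_invariant_holds (criticalBeta_nonneg 3) σ.symm x).symm
  rw [hx, hrep]
  refine integral_congr_ae (Filter.Eventually.of_forall fun s => ?_)
  exact (kernel_compPerm x σ s).symm

/-- Evaluation of the `S₃`-average of the push-forwards on a measurable set. -/
theorem symmAverage_apply (μ : Measure (Fin 3 → ℝ)) {S : Set (Fin 3 → ℝ)} (hS : MeasurableSet S) :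
    (((Fintype.card (Equiv.Perm (Fin 3)) : ENNReal)⁻¹) •
        ∑ σ : Equiv.Perm (Fin 3), μ.map fun s : Fin 3 → ℝ => s ∘ σ) S =
      ((Fintype.card (Equiv.Perm (Fin 3)) : ENNReal)⁻¹) *
        ∑ σ : Equiv.Perm (Fin 3), μ ((fun s : Fin 3 → ℝ => s ∘ σ) ⁻¹' S) := by
  simp only [Measure.smul_apply, Measure.coe_finsetSum, Finset.sum_apply, smul_eq_mul]
  congr 1
  refine Finset.sum_congr rfl fun σ _ => ?_
  rw [Measure.map_apply (measurable_compPerm σ) hS]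

/-- The `S₃`-average of the push-forwards of a probability measure is a probability measure. -/
theorem isProbabilityMeasure_symmAverage (μ : Measure (Fin 3 → ℝ)) [IsProbabilityMeasure μ] :
    IsProbabilityMeasure (((Fintype.card (Equiv.Perm (Fin 3)) : ENNReal)⁻¹) •
      ∑ σ : Equiv.Perm (Fin 3), μ.map fun s : Fin 3 → ℝ => s ∘ σ) := by
  refine ⟨?_⟩
  rw [symmAverage_apply μ MeasurableSet.univ]
  simp only [Set.preimage_univ, measure_univ, Finset.sum_const, Finset.card_univ, nsmul_eq_mul,
    mul_one]
  exact ENNReal.inv_mul_cancel (by exact_mod_cast Fintype.card_ne_zero) (ENNReal.natCast_ne_top _)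

/-- The `S₃`-average of the push-forwards of a measure carried by the closed octant is carried by
the closed octant. -/
theorem symmAverage_exists_neg {μ : Measure (Fin 3 → ℝ)} (hoct : μ {s | ∃ i, s i < 0} = 0) :
    (((Fintype.card (Equiv.Perm (Fin 3)) : ENNReal)⁻¹) •
        ∑ σ : Equiv.Perm (Fin 3), μ.map fun s : Fin 3 → ℝ => s ∘ σ) {s | ∃ i, s i < 0} = 0 := by
  rw [symmAverage_apply μ (by measurability)]
  simp only [preimage_compPerm_exists_neg, hoct, Finset.sum_const_zero, mul_zero]

/-- The `S₃`-average of the push-forwards of a measure is exchangeable (invariant under every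
coordinate permutation): re-index the average by right multiplication. -/
theorem symmAverage_exchangeable (μ : Measure (Fin 3 → ℝ)) (τ : Equiv.Perm (Fin 3)) :
    (((Fintype.card (Equiv.Perm (Fin 3)) : ENNReal)⁻¹) •
        ∑ σ : Equiv.Perm (Fin 3), μ.map fun s : Fin 3 → ℝ => s ∘ σ).map
        (fun s : Fin 3 → ℝ => s ∘ τ) =
      ((Fintype.card (Equiv.Perm (Fin 3)) : ENNReal)⁻¹) •
        ∑ σ : Equiv.Perm (Fin 3), μ.map fun s : Fin 3 → ℝ => s ∘ σ := by
  ext S hS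
  rw [Measure.map_apply (measurable_compPerm τ) hS, symmAverage_apply μ (measurable_compPerm τ hS),
    symmAverage_apply μ hS]
  congr 1
  refine Fintype.sum_equiv (Equiv.mulRight τ) _ _ fun σ => ?_
  rw [Equiv.coe_mulRight, ← Set.preimage_comp, compPerm_comp_compPerm]

/-- The `S₃`-average of the push-forwards of a probability measure on the closed octant representing
the critical two-point function again represents it. -/
theorem rep_symmAverage {μ : Measure (Fin 3 → ℝ)} [IsProbabilityMeasure μ]
    (hoct : μ {s | ∃ i, s i < 0} = 0)
    (hrep : ∀ x : Site 3, criticalTwoPoint 3 x = ∫ s, Real.exp (-∑ i, s i * ((x i : ℝ)) ^ 2) ∂μ)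
    (x : Site 3) :
    criticalTwoPoint 3 x = ∫ s, Real.exp (-∑ i, s i * ((x i : ℝ)) ^ 2)
      ∂(((Fintype.card (Equiv.Perm (Fin 3)) : ENNReal)⁻¹) •
        ∑ σ : Equiv.Perm (Fin 3), μ.map fun s : Fin 3 → ℝ => s ∘ σ) := by
  have hint : ∀ σ : Equiv.Perm (Fin 3),
      Integrable (fun s : Fin 3 → ℝ => Real.exp (-∑ i, s i * ((x i : ℝ)) ^ 2))
        (μ.map fun s : Fin 3 → ℝ => s ∘ σ) := by
    intro σ
    haveI : IsProbabilityMeasure (μ.map fun s : Fin 3 → ℝ => s ∘ σ) :=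
      Measure.isProbabilityMeasure_map (measurable_compPerm σ).aemeasurable
    exact integrable_kernel (map_compPerm_exists_neg hoct σ) x
  rw [integral_smul_measure, integral_finsetSum_measure fun σ _ => hint σ]
  simp only [← rep_map_compPerm hrep, Finset.sum_const, Finset.card_univ, nsmul_eq_mul, smul_eq_mul,
    ENNReal.toReal_inv, ENNReal.toReal_natCast]
  have hc : ((Fintype.card (Equiv.Perm (Fin 3)) : ℝ)) ≠ 0 := by exact_mod_cast Fintype.card_ne_zero
  field_simp

end CriticalTwoPointGSMSymm

open CriticalTwoPointGSMSymm in
/-- **A bare probability representation gives an exchangeable one.** If the critical two-point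
function `⟨σ₀σ_x⟩⁺_{β_c}` of the nearest-neighbour Ising model on `ℤ³` is a Gaussian scale mixture
`∫ exp(-∑ᵢ sᵢ xᵢ²) dμ(s)` with a probability mixing measure `μ` carried by the closed octant, then
it is such a mixture with an EXCHANGEABLE probability mixing measure carried by the closed octant:
the `S₃`-average of the push-forwards of `μ` under the coordinate permutations (each push-forward
represents `x ↦ G(x ∘ σ⁻¹) = G(x)` by the permutation symmetry of `⟨σ₀σ_x⟩⁺_{β_c}`,
Friedli–Velenik 2017, Exercise 3.14). -/
theorem exists_exchangeable_rep_of_rep (μ : Measure (Fin 3 → ℝ)) (hP : IsProbabilityMeasure μ)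
    (hoct : μ {s | ∃ i, s i < 0} = 0)
    (hrep : ∀ x : Site 3, criticalTwoPoint 3 x = ∫ s, Real.exp (-∑ i, s i * ((x i : ℝ)) ^ 2) ∂μ) :
    ∃ ν : Measure (Fin 3 → ℝ), IsProbabilityMeasure ν ∧ ν {s | ∃ i, s i < 0} = 0 ∧
      (∀ σ : Equiv.Perm (Fin 3), ν.map (fun s : Fin 3 → ℝ => s ∘ σ) = ν) ∧
      ∀ x : Site 3, criticalTwoPoint 3 x = ∫ s, Real.exp (-∑ i, s i * ((x i : ℝ)) ^ 2) ∂ν :=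
  ⟨((Fintype.card (Equiv.Perm (Fin 3)) : ENNReal)⁻¹) •
      ∑ σ : Equiv.Perm (Fin 3), μ.map fun s : Fin 3 → ℝ => s ∘ σ,
    @isProbabilityMeasure_symmAverage μ hP, symmAverage_exists_neg hoct, symmAverage_exchangeable μ,
    @rep_symmAverage μ hP hoct hrep⟩

end Summit.CriticalPhenomena.Ising3DConformalLimit.Theorems
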